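import Mathlib

/-!
# Hodge-locus census — MULTIPLICITY BOUND FROM ONE MAXIMAL MINOR OF A LINEAR PENCIL
(def-free helper of `stmt-HodgeConjecture-16267`; pub-hlocus, seat ivhs-2, gen 28)

Pure linear algebra behind the "minors certificate" of the cell records
`og81/FERMAT-POINT-STRUCTURE-g30.md` §3b / §4(e) (lead gen 30) and `pub-hlocus-ivhs-2/gen28/cor5/COR5-B-g28.md` (ivhs-2 gen 28):
for a pencil of matrices `A + λ B` (`A B : Matrix m n K`) and ANY choice `f : n → m` of `n` rows (a maximal minor
`D(X) = det ((A + X B).submatrix f id) ∈ K[X]`),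

* `(X - C c) ^ dim ker (A + c B) ∣ D(X)`  — the geometric multiplicity of the eigenvalue `c` is at most the order of
  vanishing at `c` of every maximal minor (`pow_finrank_ker_dvd_det_pencilMinor`, `finrank_ker_le_rootMultiplicity`);
* consequently, if ONE maximal minor equals `κ X^g (X - λ⋆)` with `κ ≠ 0`, `λ⋆ ≠ 0` (the shape certified exactly over `ℚ(ζ_2d)`
  at `k₀` in COR5-B-g28: `g = 18`, `λ⋆ = -1` for `(d,k) = (4,4)`; `g = 19`, `λ⋆ = +1` for `(3,6)`), then
  `dim ker (A + λ⋆ B) ≤ 1`, `dim ker A ≤ g`, and `ker (A + c B) = 0` for every `c ∉ {0, λ⋆}`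
  (`regular_minor_certificate`): the pencil has no finite special value other than `0` and `λ⋆`, and the excess at `λ⋆` is at most one.

Proof of the divisibility: after a change of basis `E ∈ GL_n(K)` whose first columns span `ker (A + c B)`, the corresponding
columns of `(A + X B) E` are divisible by `X - c`; pull the factors out of the determinant.

certified instances and evidence bearing on the general Hodge conjecture; no claim.
-/

namespace Summit.HodgeConjecture.HodgeConjecture.HodgeLocus.Census.PencilMinor

open Polynomial Matrix Module

variable {K : Type*} [Field K] {m n : Type*} [Fintype n] [DecidableEq n]

omit [Fintype n] [DecidableEq n] in
/-- The entries of the square pencil `A + X B` over `K[X]`. -/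
theorem pencil_apply (A B : Matrix n n K) (i j : n) :
    (A.map C + (X : K[X]) • B.map C) i j = C (A i j) + X * C (B i j) := by
  simp [Matrix.add_apply, Matrix.smul_apply, smul_eq_mul]

/-- If the columns indexed by `S` of `A + c B` vanish, then `(X - c)^|S|` divides `det (A + X B)`. -/
theorem pow_card_dvd_det_pencil_of_columns_zero (A B : Matrix n n K) (c : K) (S : Finset n)
    (hS : ∀ i ∈ S, ∀ j, A j i + c * B j i = 0) :
    (X - C c) ^ S.card ∣ (A.map C + (X : K[X]) • B.map C).det := by
  classical
  set P : Matrix n n K[X] := A.map C + (X : K[X]) • B.map C with hPdef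
  let Q : Matrix n n K[X] := fun j i => if i ∈ S then C (B j i) else P j i
  let d : n → K[X] := fun i => if i ∈ S then X - C c else 1
  have hP : P = Q * diagonal d := by
    refine Matrix.ext fun j i => ?_
    rw [mul_diagonal]
    by_cases hi : i ∈ S
    · have hA : A j i = -(c * B j i) := eq_neg_of_add_eq_zero_left (hS i hi j)
      simp only [Q, d, if_pos hi, hPdef, pencil_apply, hA, map_neg, map_mul]
      ring
    · simp only [Q, d, if_neg hi, mul_one]
  have hprod : ∏ i, d i = (X - C c) ^ S.card := by
    simp only [d]
    rw [Finset.prod_ite_mem, Finset.univ_inter, Finset.prod_const]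
  rw [hP, det_mul, det_diagonal, hprod]
  exact Dvd.intro_left _ rfl

/-- Right multiplication by a constant matrix multiplies the pencil determinant by a constant. -/
theorem det_pencil_mul (A B E : Matrix n n K) :
    ((A * E).map C + (X : K[X]) • (B * E).map C).det = (A.map C + (X : K[X]) • B.map C).det * C E.det := by
  have h : (A * E).map C + (X : K[X]) • (B * E).map C = (A.map C + (X : K[X]) • B.map C) * E.map C := by
    rw [Matrix.map_mul, Matrix.map_mul, add_mul, Matrix.smul_mul]
  rw [h, det_mul, RingHom.map_det, RingHom.mapMatrix_apply]

/-- GEOMETRIC ≤ ALGEBRAIC MULTIPLICITY (square case): `(X - c) ^ dim ker (A + c B)` divides `det (A + X B)`. -/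
theorem pow_finrank_ker_dvd_det_pencil (A B : Matrix n n K) (c : K) :
    (X - C c) ^ finrank K (LinearMap.ker (A + c • B).mulVecLin) ∣ (A.map C + (X : K[X]) • B.map C).det := by
  classical
  set M₀ : Matrix n n K := A + c • B with hM₀
  set N := LinearMap.ker M₀.mulVecLin with hN
  let bN := Module.finBasis K N
  let v : Fin (finrank K N) → (n → K) := fun k => (bN k : n → K)
  have hv : LinearIndependent K v := bN.linearIndependent.map' N.subtype N.ker_subtype
  -- extend the kernel basis to a basis of `Kⁿ`, reindexed by `n`
  have hli : LinearIndepOn K id (Set.range v) := hv.linearIndepOn_id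
  have hsub : Set.range v ⊆ hli.extend (Set.subset_univ _) := hli.subset_extend _
  set b := Module.Basis.extend hli with hbdef
  have hb : ∀ i, b i = (i : n → K) := Module.Basis.extend_apply_self hli
  haveI : Fintype ↥(hli.extend (Set.subset_univ _)) := FiniteDimensional.fintypeBasisIndex b
  have hcard : Fintype.card ↥(hli.extend (Set.subset_univ _)) = Fintype.card n := by
    rw [← Module.finrank_eq_card_basis b, Module.finrank_fintype_fun_eq_card]
  let σ : ↥(hli.extend (Set.subset_univ _)) ≃ n := Fintype.equivOfCardEq hcard
  let b' : Basis n K (n → K) := b.reindex σ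
  let E : Matrix n n K := (Pi.basisFun K n).toMatrix b'
  have hEcol : ∀ i, (fun l => E l i) = b' i := by
    intro i; funext l; simp [E, Module.Basis.toMatrix_apply]
  have hEunit : IsUnit E.det := by
    haveI := (Pi.basisFun K n).invertibleToMatrix b'
    exact Matrix.isUnit_det_of_invertible E
  -- the kernel columns of `M₀ * E`
  let emb : Fin (finrank K N) → n := fun k => σ ⟨v k, hsub (Set.mem_range_self k)⟩
  have hemb : Function.Injective emb := by
    intro k l h
    have h1 := Subtype.ext_iff.mp (σ.injective h)
    exact hv.injective h1
  let S : Finset n := Finset.univ.image emb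
  have hScard : S.card = finrank K N := by
    rw [Finset.card_image_of_injective _ hemb, Finset.card_univ, Fintype.card_fin]
  have hcolS : ∀ i ∈ S, ∀ j, (A * E) j i + c * (B * E) j i = 0 := by
    intro i hi j
    obtain ⟨k, -, rfl⟩ := Finset.mem_image.mp hi
    have hk : M₀ *ᵥ (v k) = 0 := LinearMap.mem_ker.mp (bN k).2
    have hb'k : b' (emb k) = v k := by
      simp [b', emb, Module.Basis.reindex_apply, hb]
    have h1 : (M₀ * E) j (emb k) = (M₀ *ᵥ fun l => E l (emb k)) j := rfl
    rw [hEcol, hb'k, hk] at h1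
    have h2 : (M₀ * E) j (emb k) = (A * E) j (emb k) + c * (B * E) j (emb k) := by
      simp [hM₀, add_mul, Matrix.add_apply, Matrix.smul_apply]
    rw [← h2, h1]; rfl
  have hdvd := pow_card_dvd_det_pencil_of_columns_zero (A * E) (B * E) c S hcolS
  rw [hScard, det_pencil_mul] at hdvd
  exact (IsUnit.dvd_mul_right (hEunit.map C)).mp hdvd

/-- Evaluating the pencil determinant at `c` gives `det (A + c B)`. -/
theorem eval_det_pencil (A B : Matrix n n K) (c : K) :
    eval c (A.map C + (X : K[X]) • B.map C).det = (A + c • B).det := by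
  rw [← Polynomial.coe_evalRingHom, RingHom.map_det, RingHom.mapMatrix_apply]
  congr 1
  ext i j
  simp [Matrix.map_apply, Matrix.add_apply, Matrix.smul_apply, smul_eq_mul]
  ring

/-- If the pencil determinant does not vanish at `c`, then `A + c B` is injective. -/
theorem ker_eq_bot_of_eval_det_ne_zero (A B : Matrix n n K) (c : K)
    (h : eval c (A.map C + (X : K[X]) • B.map C).det ≠ 0) :
    LinearMap.ker (A + c • B).mulVecLin = ⊥ := by
  rw [eval_det_pencil] at h
  rw [Matrix.ker_mulVecLin_eq_bot_iff]
  intro v hv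
  by_contra hne
  exact h (Matrix.exists_mulVec_eq_zero_iff.mp ⟨v, hne, hv⟩)

/-- Multiplicity form: `dim ker (A + c B) ≤ ord_c det (A + X B)` whenever the determinant is not the zero polynomial. -/
theorem finrank_ker_le_rootMultiplicity (A B : Matrix n n K) (c : K)
    (hdet : (A.map C + (X : K[X]) • B.map C).det ≠ 0) :
    finrank K (LinearMap.ker (A + c • B).mulVecLin) ≤ rootMultiplicity c (A.map C + (X : K[X]) • B.map C).det :=
  (Polynomial.le_rootMultiplicity_iff hdet).mpr (pow_finrank_ker_dvd_det_pencil A B c)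

/-! ### Rectangular pencils: restricting to the rows of a maximal minor can only enlarge the kernel -/

omit [DecidableEq n] in
/-- The kernel of `M` is contained in the kernel of any row-selection of `M`. -/
theorem ker_le_ker_submatrix (M : Matrix m n K) (f : n → m) :
    LinearMap.ker M.mulVecLin ≤ LinearMap.ker (M.submatrix f id).mulVecLin := by
  intro v hv
  rw [LinearMap.mem_ker, Matrix.mulVecLin_apply] at hv ⊢
  funext i
  have := congrFun hv (f i)
  simpa [Matrix.mulVec, Matrix.submatrix_apply, dotProduct] using this

omit [Fintype n] [DecidableEq n] in
/-- Row-selection commutes with forming the pencil `A + c B`. -/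
theorem submatrix_pencil (A B : Matrix m n K) (c : K) (f : n → m) :
    (A + c • B).submatrix f id = A.submatrix f id + c • B.submatrix f id := by
  ext i j; simp

/-- GEOMETRIC ≤ ALGEBRAIC MULTIPLICITY for a rectangular pencil and any maximal minor:
`(X - c) ^ dim ker (A + c B) ∣ det ((A + X B)|_rows f)`. -/
theorem pow_finrank_ker_dvd_det_pencilMinor (A B : Matrix m n K) (c : K) (f : n → m) :
    (X - C c) ^ finrank K (LinearMap.ker (A + c • B).mulVecLin) ∣
      ((A.submatrix f id).map C + (X : K[X]) • (B.submatrix f id).map C).det := by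
  have h1 := pow_finrank_ker_dvd_det_pencil (A.submatrix f id) (B.submatrix f id) c
  have hle : finrank K (LinearMap.ker (A + c • B).mulVecLin) ≤
      finrank K (LinearMap.ker (A.submatrix f id + c • B.submatrix f id).mulVecLin) := by
    rw [← submatrix_pencil]
    exact Submodule.finrank_mono (ker_le_ker_submatrix (A + c • B) f)
  exact (pow_dvd_pow _ hle).trans h1

/-- THE REGULAR-MINOR CERTIFICATE.  If some maximal minor of the pencil `A + X B` equals `κ · X^g · (X - λ⋆)` with
`κ ≠ 0` and `λ⋆ ≠ 0`, then: the excess at `λ⋆` is at most `1`, `dim ker A ≤ g`, and `A + c B` is injective for every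
`c ∉ {0, λ⋆}` (no other finite special value). -/
theorem regular_minor_certificate (A B : Matrix m n K) (f : n → m) (κ lstar : K) (g : ℕ)
    (hκ : κ ≠ 0) (hl : lstar ≠ 0)
    (hD : ((A.submatrix f id).map C + (X : K[X]) • (B.submatrix f id).map C).det = C κ * X ^ g * (X - C lstar)) :
    finrank K (LinearMap.ker (A + lstar • B).mulVecLin) ≤ 1 ∧
    finrank K (LinearMap.ker A.mulVecLin) ≤ g ∧
    ∀ c : K, c ≠ 0 → c ≠ lstar → LinearMap.ker (A + c • B).mulVecLin = ⊥ := by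
  have hXl : (X - C lstar : K[X]) ≠ 0 := X_sub_C_ne_zero lstar
  refine ⟨?_, ?_, ?_⟩
  · -- excess at λ⋆
    have h := pow_finrank_ker_dvd_det_pencilMinor A B lstar f
    rw [hD] at h
    by_contra hr
    have hr2 : 2 ≤ finrank K (LinearMap.ker (A + lstar • B).mulVecLin) := by omega
    have h2 : (X - C lstar) ^ 2 ∣ C κ * X ^ g * (X - C lstar) := (pow_dvd_pow _ hr2).trans h
    rw [pow_two] at h2
    have h3 : (X - C lstar : K[X]) ∣ C κ * X ^ g := (mul_dvd_mul_iff_right hXl).mp h2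
    have h4 := (Polynomial.dvd_iff_isRoot).mp h3
    simp only [IsRoot.def, eval_mul, eval_C, eval_pow, eval_X] at h4
    exact (mul_ne_zero hκ (pow_ne_zero g hl)) h4
  · -- dim ker A ≤ g
    have h := pow_finrank_ker_dvd_det_pencilMinor A B 0 f
    rw [hD, zero_smul, add_zero, map_zero, sub_zero] at h
    by_contra hr
    have hr2 : g + 1 ≤ finrank K (LinearMap.ker A.mulVecLin) := by omega
    have h2 : (X : K[X]) ^ (g + 1) ∣ C κ * X ^ g * (X - C lstar) := (pow_dvd_pow _ hr2).trans h
    have h3 : (X : K[X]) ∣ C κ * (X - C lstar) := by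
      have hXg : (X : K[X]) ^ g ≠ 0 := pow_ne_zero g X_ne_zero
      have : (X : K[X]) ^ g * X ∣ (X : K[X]) ^ g * (C κ * (X - C lstar)) := by
        rw [← pow_succ]; convert h2 using 1; ring
      exact (mul_dvd_mul_iff_left hXg).mp this
    have h4 := (Polynomial.dvd_iff_isRoot.mp (by simpa using h3 : (X - C (0 : K)) ∣ C κ * (X - C lstar)))
    simp only [IsRoot.def, eval_mul, eval_C, eval_sub, eval_X] at h4
    apply hκ
    have : κ * lstar = 0 := by linear_combination (-1 : K) * h4
    exact (mul_eq_zero.mp this).resolve_right hl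
  · -- no other finite special value
    intro c hc0 hcl
    have hle := ker_le_ker_submatrix (A + c • B) f
    rw [submatrix_pencil] at hle
    have hbot : LinearMap.ker (A.submatrix f id + c • B.submatrix f id).mulVecLin = ⊥ := by
      apply ker_eq_bot_of_eval_det_ne_zero
      rw [hD]
      simp only [eval_mul, eval_C, eval_pow, eval_X, eval_sub]
      exact mul_ne_zero (mul_ne_zero hκ (pow_ne_zero g hc0)) (sub_ne_zero.mpr hcl)
    rw [hbot] at hle
    exact le_bot_iff.mp hle

end Summit.HodgeConjecture.HodgeConjecture.HodgeLocus.Census.PencilMinor
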